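import Mathlib
import Literature.Analysis.ODE.CodeListMeanValueExtension
import Summits.Ventures.FusionMHD.Models.CerfonFreidbergIterLikeCriticalPoint
import Summits.Ventures.FusionMHD.Models.CerfonFreidbergIterLikePointValues
import HarnessLib

/-!
# Ventures/FusionMHD — Models/CerfonFreidbergIterLikePlasmaSection.lean: every vertical section of the model plasma of the CF ITER-like
# flux of record is ONE symmetric interval — the plasma in its bounding box is a single lens `|Y| < Y⋆(X)` (kernel; 13 range certificates)

HONEST FRAMING (LADDER-GRIDFUSION three columns; CF rung, qualitative companion of S2 #34 «F1.CF-AXIS-ITER», of «#34″ CF-MIDPLANE» and of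
`Models/CerfonFreidbergIterLikeCriticalPoint.lean`).  The CriticalPoint file proved that on the bounding box `17/25 ≤ X ≤ 33/25`, `|Y| ≤ 3/5`
every vertical section `Y ↦ U(X, Y)` of THE flux of record strictly decreases on `[−3/5, 0]` and strictly increases on `[0, 3/5]`; the Midplane
file that `U(X, 0) < 0` on the open chord.  THIS FILE adds the missing sign on the LID of the box: **`U(X, ±3/5) ≥ 1/500 > 0` for all
`17/25 ≤ X ≤ 33/25`** (`U_top_pos`, `U_bottom_pos`) — THIRTEEN natural-interval-extension range certificates (`evalBoxLE`, Moore 1966 Thm 3.1) of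
the code list `uExpr` of `U(X, W; c) = G₀(X) + G₂(X) W + G₄(X) W² + G₆ W³` (`W = Y²`, tree `cfSolution_zero_vertical`) over «(#34's kernel
coefficient box) × (X-piece) × (W = 9/25)», pieces 17/25 | 3/4 | 79/100 | 41/50 | 21/25 | 43/50 | 22/25 | 9/10 | 23/25 | 19/20 | 99/100 | 53/50 |
121/100 | 33/25 (the lid passes only ≈ 0.056 above the plasma top `κε = 68/125`, hence the fine pieces near `X ≈ 1 − δε`).  Consequence
(`plasma_section`): **for every `X` of the open chord there is ONE height `Y⋆(X) ∈ (0, 3/5)` with `U(X, ±Y⋆) = 0`, and for `|Y| ≤ 3/5`: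
`U(X, Y) < 0 ⟺ |Y| < Y⋆(X)`** — each vertical section of the model plasma `{U < 0}` inside the box is a single interval symmetric about the
midplane (no detached plasma, no private-flux pocket, no second lobe inside the bounding box); `U(X, Y) = U(X, |Y|)` (`U_abs`, from the
landed symmetry `U_neg` of `Models/CerfonFreidbergIterLikePointValues.lean`).
CERTIFIED (kernel): as stated, for the model flux on that box.  MODELLED: analytic CF family (ideal MHD, Solov'ev profiles, fixed analytic
boundary); a statement about the sign pattern of the model flux — no stability content, nothing outside the box.
Typer/prover: gridfusion-model-5 (g5), 2026-08-27.  Citations: Freidberg 2014 §6.6.1 (6.151)–(6.155) [Freidberg2014]; Moore 1966 Thm 3.1 /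
Moore 1979 §4.3 [Moore1979].
-/

noncomputable section

open Set NonemptyInterval Matrix
open Literature.Analysis.ODE Literature.Analysis.ODE.FExpr
open Literature.Analysis.ValidatedNumerics Literature.Analysis.ValidatedNumerics.ITaylor
open Literature.MathematicalPhysics.MHD Literature.MathematicalPhysics.MHD.GradShafranov
  Literature.MathematicalPhysics.MHD.CerfonFreidberg _root_.Real

namespace Summit.Ventures.FusionMHD.Models.CFIterLike

/-! ## §1 The code list of `U(X, W; c)` and the thirteen lid certificates -/

/-- Code list of `U(X, W; c) = G₀(X) + G₂(X) W + G₄(X) W² + G₆ W³` (`W = Y²`): unknowns `x₀…x₆ = c₀…c₆`, `x₇ = X`, `x₈ = W`; polynomial part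
Horner in `X²`, one logarithm.  MODELLED: analytic CF family. -/
def uExpr : FExpr 9 :=
  add
    (add (add (add (add (var 0) (mul (var 2) (var 8))) (mul (smul 2 (var 4)) (pow (var 8) 2))) (mul (smul 8 (var 6)) (pow (var 8) 3)))
      (mul (pow (var 7) 2) (add
        (add (add (var 1) (mul (add (smul (-4) (var 3)) (smul (-9) (var 4))) (var 8))) (mul (add (smul 8 (var 5)) (smul (-140) (var 6))) (pow (var 8) 2)))
        (mul (pow (var 7) 2) (add (add (add (const (1 / 8)) (var 3)) (mul (add (smul (-12) (var 5)) (smul 75 (var 6))) (var 8)))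
          (mul (pow (var 7) 2) (var 5)))))))
    (mul (log (var 7)) (mul (pow (var 7) 2) (add
        (add (add (smul (-1) (var 2)) (mul (smul (-12) (var 4)) (var 8))) (mul (smul (-120) (var 6)) (pow (var 8) 2)))
        (mul (pow (var 7) 2) (add (add (smul 3 (var 4)) (mul (smul 180 (var 6)) (var 8))) (mul (pow (var 7) 2) (smul (-15) (var 6))))))))

/-- The thirteen `X`-pieces of the lid `[17/25, 33/25] × {W = 9/25}` (fine where the lid is close to the plasma top). -/
def topPiece : Fin 13 → Iv :=
  ![⟨((17 / 25), (3 / 4)), by decide +kernel⟩,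
    ⟨((3 / 4), (79 / 100)), by decide +kernel⟩,
    ⟨((79 / 100), (41 / 50)), by decide +kernel⟩,
    ⟨((41 / 50), (21 / 25)), by decide +kernel⟩,
    ⟨((21 / 25), (43 / 50)), by decide +kernel⟩,
    ⟨((43 / 50), (22 / 25)), by decide +kernel⟩,
    ⟨((22 / 25), (9 / 10)), by decide +kernel⟩,
    ⟨((9 / 10), (23 / 25)), by decide +kernel⟩,
    ⟨((23 / 25), (19 / 20)), by decide +kernel⟩,
    ⟨((19 / 20), (99 / 100)), by decide +kernel⟩,
    ⟨((99 / 100), (53 / 50)), by decide +kernel⟩,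
    ⟨((53 / 50), (121 / 100)), by decide +kernel⟩,
    ⟨((121 / 100), (33 / 25)), by decide +kernel⟩]

/-- The degenerate `W`-interval `{9/25}` (`Y = ±3/5`). -/
def wTop : Iv := ⟨((9 / 25), (9 / 25)), by decide +kernel⟩

/-- «#34's coefficient box × X-piece `j` × {W = 9/25}». -/
def topBox (j : Fin 13) : Fin 9 → Iv :=
  fun i => if h : (i : ℕ) < 7 then axKrawczyk.box ⟨i, by omega⟩ else if (i : ℕ) = 7 then topPiece j else wTop

/-- Endpoints of the pieces (decided). -/
theorem topPiece_eq :
    ((topPiece 0).fst = 17 / 25 ∧ (topPiece 0).snd = 3 / 4) ∧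
    ((topPiece 1).fst = 3 / 4 ∧ (topPiece 1).snd = 79 / 100) ∧
    ((topPiece 2).fst = 79 / 100 ∧ (topPiece 2).snd = 41 / 50) ∧
    ((topPiece 3).fst = 41 / 50 ∧ (topPiece 3).snd = 21 / 25) ∧
    ((topPiece 4).fst = 21 / 25 ∧ (topPiece 4).snd = 43 / 50) ∧
    ((topPiece 5).fst = 43 / 50 ∧ (topPiece 5).snd = 22 / 25) ∧
    ((topPiece 6).fst = 22 / 25 ∧ (topPiece 6).snd = 9 / 10) ∧
    ((topPiece 7).fst = 9 / 10 ∧ (topPiece 7).snd = 23 / 25) ∧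
    ((topPiece 8).fst = 23 / 25 ∧ (topPiece 8).snd = 19 / 20) ∧
    ((topPiece 9).fst = 19 / 20 ∧ (topPiece 9).snd = 99 / 100) ∧
    ((topPiece 10).fst = 99 / 100 ∧ (topPiece 10).snd = 53 / 50) ∧
    ((topPiece 11).fst = 53 / 50 ∧ (topPiece 11).snd = 121 / 100) ∧
    ((topPiece 12).fst = 121 / 100 ∧ (topPiece 12).snd = 33 / 25) := by
  decide +kernel

/-- Endpoints of `wTop` (decided). -/
theorem wTop_eq : wTop.fst = 9 / 25 ∧ wTop.snd = 9 / 25 := by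
  decide +kernel

/-- **THE THIRTEEN LID CERTIFICATES:** on every piece the natural interval extension of `U(X, 9/25; c)` lies in `[1/500, 1/5]`. -/
theorem lid_range_cert : ∀ j : Fin 13, evalBoxLE ⟨64, 60, 56, 4, 0⟩ uExpr (topBox j) ⟨((1 / 500), (1 / 5)), by decide +kernel⟩ = true := by
  decide +kernel

/-! ## §2 Bridge and membership -/

/-- `⟦uExpr⟧(y) = G₀ + G₂ W + G₄ W² + G₆ W³` at `(hCoeffs y, y₇, y₈)`. -/
theorem eval_uExpr (y : Fin 9 → ℝ) :
    uExpr.eval y = vertG₀ (hCoeffs y) (y 7) + vertG₂ (hCoeffs y) (y 7) * y 8 + vertG₄ (hCoeffs y) (y 7) * y 8 ^ 2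
      + vertG₆ (hCoeffs y) (y 7) * y 8 ^ 3 := by
  simp [uExpr, FExpr.eval, hCoeffs, vertG₀, vertG₂, vertG₄, vertG₆]
  ring

/-- For `X` in piece `j`, `(coeff, X, 9/25) ∈ topBox j`. -/
theorem hPoint_mem_topBox {j : Fin 13} {X : ℝ} (hlo : ((topPiece j).fst : ℝ) ≤ X) (hhi : X ≤ ((topPiece j).snd : ℝ)) :
    hPoint X (9 / 25) ∈ boxSet (castBox (topBox j)) := by
  have hz := mem_boxSet_iff.mp axZero_mem
  rw [mem_boxSet_iff]
  intro i
  rw [castBox_apply, mem_ratCast_iff]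
  by_cases hi : (i : ℕ) < 7
  · have h := hz ⟨i, by omega⟩
    rw [castBox_apply, mem_ratCast_iff] at h
    simp only [topBox, hPoint, hi, dif_pos]
    exact h
  · by_cases h7 : (i : ℕ) = 7
    · simp only [topBox, hPoint, h7, if_true]
      exact ⟨hlo, hhi⟩
    · simp only [topBox, hPoint, hi, h7, dif_neg, not_false_eq_true, if_false]
      rw [wTop_eq.1, wTop_eq.2]; push_cast
      exact ⟨by norm_num, by norm_num⟩

/-! ## §3 The lid of the box is in vacuum: `U(X, ±3/5) ≥ 1/500` -/

/-- `U(X, Y)` through the vertical normal form. -/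
theorem U_eq_vert (X Y : ℝ) :
    U X Y = vertG₀ coeff X + vertG₂ coeff X * Y ^ 2 + vertG₄ coeff X * Y ^ 4 + vertG₆ coeff X * Y ^ 6 :=
  congrFun (U_vertical_eq X) Y

/-- `U(X, Y) = U(X, |Y|)`. -/
theorem U_abs (X Y : ℝ) : U X Y = U X |Y| := by
  rcases abs_choice Y with h | h
  · rw [h]
  · rw [h, U_neg]

/-- **`U(X, 3/5) ≥ 1/500 > 0` for `17/25 ≤ X ≤ 33/25`** (the lid of the bounding box lies in the model vacuum). -/
theorem U_top_pos {X : ℝ} (h1 : (17 : ℝ) / 25 ≤ X) (h2 : X ≤ 33 / 25) : 1 / 500 ≤ U X (3 / 5) := by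
  have key : ∀ j : Fin 13, ((topPiece j).fst : ℝ) ≤ X → X ≤ ((topPiece j).snd : ℝ) → 1 / 500 ≤ U X (3 / 5) := by
    intro j hlo hhi
    have hmem := hPoint_mem_topBox hlo hhi
    have h := eval_mem_of_evalBoxLE (lid_range_cert j) hmem
    rw [mem_ratCast_iff] at h
    have hev : uExpr.eval (hPoint X (9 / 25)) = U X (3 / 5) := by
      rw [eval_uExpr, hCoeffs_hPoint, hPoint_seven, hPoint_eight, U_eq_vert]; ring
    rw [hev] at h
    have : (((1 : ℚ) / 500 : ℚ) : ℝ) = 1 / 500 := by push_cast; ring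
    linarith [h.1]
  obtain ⟨⟨l0, r0⟩, ⟨l1, r1⟩, ⟨l2, r2⟩, ⟨l3, r3⟩, ⟨l4, r4⟩, ⟨l5, r5⟩, ⟨l6, r6⟩, ⟨l7, r7⟩, ⟨l8, r8⟩, ⟨l9, r9⟩, ⟨l10, r10⟩, ⟨l11, r11⟩, ⟨l12, r12⟩⟩ := topPiece_eq
  by_cases h0 : X ≤ 3 / 4
  · exact key 0 (by rw [l0]; push_cast; linarith) (by rw [r0]; push_cast; linarith)
  by_cases h1 : X ≤ 79 / 100
  · exact key 1 (by rw [l1]; push_cast; linarith) (by rw [r1]; push_cast; linarith)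
  by_cases h2 : X ≤ 41 / 50
  · exact key 2 (by rw [l2]; push_cast; linarith) (by rw [r2]; push_cast; linarith)
  by_cases h3 : X ≤ 21 / 25
  · exact key 3 (by rw [l3]; push_cast; linarith) (by rw [r3]; push_cast; linarith)
  by_cases h4 : X ≤ 43 / 50
  · exact key 4 (by rw [l4]; push_cast; linarith) (by rw [r4]; push_cast; linarith)
  by_cases h5 : X ≤ 22 / 25
  · exact key 5 (by rw [l5]; push_cast; linarith) (by rw [r5]; push_cast; linarith)
  by_cases h6 : X ≤ 9 / 10
  · exact key 6 (by rw [l6]; push_cast; linarith) (by rw [r6]; push_cast; linarith)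
  by_cases h7 : X ≤ 23 / 25
  · exact key 7 (by rw [l7]; push_cast; linarith) (by rw [r7]; push_cast; linarith)
  by_cases h8 : X ≤ 19 / 20
  · exact key 8 (by rw [l8]; push_cast; linarith) (by rw [r8]; push_cast; linarith)
  by_cases h9 : X ≤ 99 / 100
  · exact key 9 (by rw [l9]; push_cast; linarith) (by rw [r9]; push_cast; linarith)
  by_cases h10 : X ≤ 53 / 50
  · exact key 10 (by rw [l10]; push_cast; linarith) (by rw [r10]; push_cast; linarith)
  by_cases h11 : X ≤ 121 / 100
  · exact key 11 (by rw [l11]; push_cast; linarith) (by rw [r11]; push_cast; linarith)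
  · exact key 12 (by rw [l12]; push_cast; linarith) (by rw [r12]; push_cast; linarith)

/-- **`U(X, −3/5) ≥ 1/500`** as well (symmetry). -/
theorem U_bottom_pos {X : ℝ} (h1 : (17 : ℝ) / 25 ≤ X) (h2 : X ≤ 33 / 25) : 1 / 500 ≤ U X (-(3 : ℝ) / 5) := by
  rw [show (-(3 : ℝ) / 5) = -(3 / 5) by ring, U_neg]; exact U_top_pos h1 h2

/-! ## §4 Every vertical section of the model plasma is one symmetric interval -/

/-- **THE PLASMA SECTION THEOREM:** for every `X` of the open chord `(17/25, 33/25)` there is a height `Y⋆ ∈ (0, 3/5)` with `U(X, Y⋆) = 0`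
such that for all `|Y| ≤ 3/5`: `U(X, Y) < 0 ⟺ |Y| < Y⋆`, `U(X, Y) = 0 ⟺ |Y| = Y⋆`, and `Y⋆` is the only zero of `U(X, ·)` on `[0, 3/5]`. -/
theorem plasma_section {X : ℝ} (hX : X ∈ Ioo (17 / 25 : ℝ) (33 / 25)) :
    ∃ Ys : ℝ, Ys ∈ Ioo (0 : ℝ) (3 / 5) ∧ U X Ys = 0 ∧
      (∀ Y : ℝ, Y ∈ Icc (-(3 : ℝ) / 5) (3 / 5) → (U X Y < 0 ↔ |Y| < Ys)) ∧
      (∀ Y : ℝ, Y ∈ Icc (-(3 : ℝ) / 5) (3 / 5) → (U X Y = 0 ↔ |Y| = Ys)) := by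
  have hXc : X ∈ Icc (17 / 25 : ℝ) (33 / 25) := ⟨hX.1.le, hX.2.le⟩
  have hneg : U X 0 < 0 := U_midplane_neg hX.1 hX.2
  have hpos : 0 < U X (3 / 5) := lt_of_lt_of_le (by norm_num) (U_top_pos hXc.1 hXc.2)
  have hcont : ContinuousOn (U X) (Icc 0 (3 / 5 : ℝ)) := (continuous_U_vertical X).continuousOn
  obtain ⟨Ys, hYs, hzero⟩ := intermediate_value_Ioo (by norm_num : (0 : ℝ) ≤ 3 / 5) hcont ⟨hneg, hpos⟩
  have hmono := strictMonoOn_U_vertical hXc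
  have hYsI : Ys ∈ Icc (0 : ℝ) (3 / 5) := ⟨hYs.1.le, hYs.2.le⟩
  refine ⟨Ys, hYs, hzero, ?_, ?_⟩
  · intro Y hY
    have haI : |Y| ∈ Icc (0 : ℝ) (3 / 5) := ⟨abs_nonneg Y, abs_le.mpr ⟨by linarith [hY.1], hY.2⟩⟩
    rw [U_abs, ← hzero]
    exact hmono.lt_iff_lt haI hYsI
  · intro Y hY
    have haI : |Y| ∈ Icc (0 : ℝ) (3 / 5) := ⟨abs_nonneg Y, abs_le.mpr ⟨by linarith [hY.1], hY.2⟩⟩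
    rw [U_abs, ← hzero]
    exact ⟨fun h => hmono.injOn haI hYsI h, fun h => by rw [h]⟩

/-- On the two end lines of the chord the box meets no plasma: `U(17/25, Y) ≥ 0` and `U(33/25, Y) ≥ 0` for `|Y| ≤ 3/5`, with equality only
on the midplane. -/
theorem U_endlines_nonneg {Y : ℝ} (hY : Y ∈ Icc (-(3 : ℝ) / 5) (3 / 5)) : 0 ≤ U (17 / 25) Y ∧ 0 ≤ U (33 / 25) Y := by
  have hl : (17 / 25 : ℝ) ∈ Icc (17 / 25 : ℝ) (33 / 25) := ⟨le_rfl, by norm_num⟩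
  have hr : (33 / 25 : ℝ) ∈ Icc (17 / 25 : ℝ) (33 / 25) := ⟨by norm_num, le_rfl⟩
  obtain ⟨e1, e2⟩ := U_chord_ends
  by_cases h0 : Y = 0
  · subst h0; exact ⟨e1.symm.le, e2.symm.le⟩
  · exact ⟨by linarith [U_midplane_lt_of_ne hl hY h0], by linarith [U_midplane_lt_of_ne hr hY h0]⟩

/-! ## §5 (APPENDED) The model plasma in the bounding box AS A SET: the open lens under the graph of `Y⋆` -/

/-- **The half-height `Y⋆(X)` of the model plasma** at abscissa `X`: the height delivered by `plasma_section` on the open chord, `0` elsewhere. -/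
def Ystar (X : ℝ) : ℝ :=
  if h : X ∈ Ioo (17 / 25 : ℝ) (33 / 25) then Classical.choose (plasma_section h) else 0

/-- The defining properties of `Y⋆(X)` on the open chord. -/
theorem Ystar_spec {X : ℝ} (hX : X ∈ Ioo (17 / 25 : ℝ) (33 / 25)) :
    Ystar X ∈ Ioo (0 : ℝ) (3 / 5) ∧ U X (Ystar X) = 0 ∧
      (∀ Y : ℝ, Y ∈ Icc (-(3 : ℝ) / 5) (3 / 5) → (U X Y < 0 ↔ |Y| < Ystar X)) ∧
      (∀ Y : ℝ, Y ∈ Icc (-(3 : ℝ) / 5) (3 / 5) → (U X Y = 0 ↔ |Y| = Ystar X)) := by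
  unfold Ystar
  rw [dif_pos hX]
  exact Classical.choose_spec (plasma_section hX)

/-- On the two end lines the flux vanishes only on the midplane. -/
theorem U_endline_eq_zero_iff {Y : ℝ} (hY : Y ∈ Icc (-(3 : ℝ) / 5) (3 / 5)) :
    (U (17 / 25) Y = 0 ↔ Y = 0) ∧ (U (33 / 25) Y = 0 ↔ Y = 0) := by
  have hl : (17 / 25 : ℝ) ∈ Icc (17 / 25 : ℝ) (33 / 25) := ⟨le_rfl, by norm_num⟩
  have hr : (33 / 25 : ℝ) ∈ Icc (17 / 25 : ℝ) (33 / 25) := ⟨by norm_num, le_rfl⟩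
  obtain ⟨e1, e2⟩ := U_chord_ends
  refine ⟨⟨fun h => ?_, fun h => by rw [h]; exact e1⟩, ⟨fun h => ?_, fun h => by rw [h]; exact e2⟩⟩
  · by_contra hne
    have := U_midplane_lt_of_ne hl hY hne
    rw [e1, h] at this; exact lt_irrefl _ this
  · by_contra hne
    have := U_midplane_lt_of_ne hr hY hne
    rw [e2, h] at this; exact lt_irrefl _ this

/-- **THE MODEL PLASMA IN ITS BOUNDING BOX IS THE OPEN LENS `{17/25 < X < 33/25, |Y| < Y⋆(X)}`:** the set of box points with `U < 0`
equals the region strictly under the graph of `Y⋆` and strictly above the graph of `−Y⋆` over the open chord. -/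
theorem plasmaBox_eq :
    {p : ℝ × ℝ | p.1 ∈ Icc (17 / 25 : ℝ) (33 / 25) ∧ p.2 ∈ Icc (-(3 : ℝ) / 5) (3 / 5) ∧ U p.1 p.2 < 0}
      = {p : ℝ × ℝ | p.1 ∈ Ioo (17 / 25 : ℝ) (33 / 25) ∧ |p.2| < Ystar p.1} := by
  ext p
  simp only [mem_setOf_eq]
  constructor
  · rintro ⟨hX, hY, hU⟩
    have h1 : (17 / 25 : ℝ) < p.1 := by
      rcases eq_or_lt_of_le hX.1 with h | h
      · exfalso
        have := (U_endlines_nonneg hY).1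
        rw [h] at this; linarith
      · exact h
    have h2 : p.1 < 33 / 25 := by
      rcases eq_or_lt_of_le hX.2 with h | h
      · exfalso
        have := (U_endlines_nonneg hY).2
        rw [← h] at this; linarith
      · exact h
    have hXo : p.1 ∈ Ioo (17 / 25 : ℝ) (33 / 25) := ⟨h1, h2⟩
    exact ⟨hXo, ((Ystar_spec hXo).2.2.1 p.2 hY).mp hU⟩
  · rintro ⟨hXo, hlt⟩
    have hs := Ystar_spec hXo
    have hY : p.2 ∈ Icc (-(3 : ℝ) / 5) (3 / 5) := by
      have hb : |p.2| < 3 / 5 := lt_trans hlt hs.1.2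
      constructor <;> [linarith [(abs_lt.mp hb).1]; linarith [(abs_lt.mp hb).2]]
    exact ⟨⟨hXo.1.le, hXo.2.le⟩, hY, (hs.2.2.1 p.2 hY).mpr hlt⟩

/-- **… and its boundary inside the box is the pair of graphs `Y = ±Y⋆(X)` plus the two chord end points.** -/
theorem plasmaBoundaryBox_eq :
    {p : ℝ × ℝ | p.1 ∈ Icc (17 / 25 : ℝ) (33 / 25) ∧ p.2 ∈ Icc (-(3 : ℝ) / 5) (3 / 5) ∧ U p.1 p.2 = 0}
      = {p : ℝ × ℝ | p.1 ∈ Ioo (17 / 25 : ℝ) (33 / 25) ∧ p.2 ∈ Icc (-(3 : ℝ) / 5) (3 / 5) ∧ |p.2| = Ystar p.1}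
        ∪ {((17 : ℝ) / 25, 0), ((33 : ℝ) / 25, 0)} := by
  ext p
  simp only [mem_setOf_eq, mem_union, mem_insert_iff, mem_singleton_iff]
  constructor
  · rintro ⟨hX, hY, hU⟩
    rcases eq_or_lt_of_le hX.1 with h | h1
    · right; left
      have h0 : p.2 = 0 := by
        have := (U_endline_eq_zero_iff hY).1
        rw [h] at this; exact this.mp hU
      exact Prod.ext h.symm h0
    rcases eq_or_lt_of_le hX.2 with h | h2
    · right; right
      have h0 : p.2 = 0 := by
        have := (U_endline_eq_zero_iff hY).2
        rw [← h] at this; exact this.mp hU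
      exact Prod.ext h h0
    · left
      have hXo : p.1 ∈ Ioo (17 / 25 : ℝ) (33 / 25) := ⟨h1, h2⟩
      exact ⟨hXo, hY, ((Ystar_spec hXo).2.2.2 p.2 hY).mp hU⟩
  · rintro (⟨hXo, hY, habs⟩ | hp | hp)
    · exact ⟨⟨hXo.1.le, hXo.2.le⟩, hY, ((Ystar_spec hXo).2.2.2 p.2 hY).mpr habs⟩
    · subst hp
      exact ⟨⟨le_rfl, by norm_num⟩, ⟨by norm_num, by norm_num⟩, U_chord_ends.1⟩
    · subst hp
      exact ⟨⟨by norm_num, le_rfl⟩, ⟨by norm_num, by norm_num⟩, U_chord_ends.2⟩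

end Summit.Ventures.FusionMHD.Models.CFIterLike
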